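import Mathlib
import Summits.NavierStokesRegularity.NavierStokesRegularity.Theorems.ThreadingFluxHorizonTowerL2DetReduction
import HarnessLib

/-!
# Crux `PoloidalLiouville` (stmt-NavierStokesRegularity-1222, wall W1), crux idea «horizon-threading-tower» (ns-idea-15):
# the BOUNDED-ENDPOINT TAIL RUNG follows from the order-two horizon law, BY NAME

Support file (Theorems-side tooling; seat ns-wall-eng-4 g2, cell ns-wall-extremal, W1 adjunct; `--supports stmt-NavierStokesRegularity-1222
--as helper`).  The card books `BoundedEndpointTailRung` (V9-P1's repair of the window rung) as «a COROLLARY of `OrderTwoHorizonLaw`»; this file makes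
that a kernel implication between the typed statements of `Theorems/ThreadingFluxHorizonTowerDefs.lean`:

* `HorizonTower.curl_const_smul_field`, `horizonProfile_const_mul` — `curl (c V) = c curl V` with junk values included, hence
  `horizonProfile l (c H) x₀ = c · horizonProfile l H x₀` as functions;
* `HorizonTower.curl_comp_sub`, `horizonProfile_translate`, `horizonL2_translate` — translation covariance of `curl`, of the horizon profile and
  of `𝔏₂` (`horizonL2 (W ∘ (· − x₀)) x₀ x = horizonL2 W 0 (x − x₀)`);
* `HorizonTower.contDiffAt_horizonProfile`, `contDiffOn_horizonProfile_centre`, `isZeroHomogeneousAbout_horizonProfile_centre` — the profile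
  about a centre `x₀` is smooth off `x₀` and degree-0 homogeneous about it;
* `HorizonTower.gradient_smul_of_posHomogeneous`, `det_const_mul`, `det_smul` — the Jacobian `det(∇H, ∇‖∇H‖², x)` scales like `c³` in `H` and
  like `ρ^{3(l−1)}` in `x`; `horizonL2_horizonProfile_smul_eq_zero_iff` — `𝔏₂[U_H](ρx) = 0 ↔ 𝔏₂[U_H](x) = 0` (`ρ > 0`, `l ≥ 2`);
* ★ `HorizonTower.boundedEndpointTailRung_of_orderTwoHorizonLaw : OrderTwoHorizonLaw → BoundedEndpointTailRung` — take `U = horizonProfile l (cH) x₀`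
  in the law; the flux vanishes identically on the open window, so `ρ² ∂ₜ²F ≡ 0 → 𝔏₂[U](x₀ + ξ)`, i.e. `𝔏₂[U] = 0` on the unit sphere about `x₀`;
  undo `c` (`det` is cubic in `H`) and the radius (`det` is homogeneous) through the closed-form law (`horizonL2_horizonProfile_eq_zero_iff`, p673002).

HONEST LABEL: a CONDITIONAL rung (the lever `OrderTwoHorizonLaw` — far-field asymptotics of `c₂` for classical NS solutions — is NOT proved here or
anywhere in the tree); information-grade for W1/W2 (movement 0); `PoloidalLiouville` (1222), `UnthreadedRigidity` (27585) and NS regularity remain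
OPEN and untouched.  [cite: MajdaBertozziCUP2002, §1.1 (vector identities)]
-/

-- the summit and its single problem share the name (D-0017 nested layout)
set_option linter.dupNamespace false

noncomputable section

open Set Function Filter Topology
open scoped Topology RealInnerProductSpace
open Literature.Analysis.FluidPDE

namespace Summit.NavierStokesRegularity.NavierStokesRegularity.Theorems.PoloidalLiouville.HorizonTower

open OrderTwo

/-! ### Scalars and translations through `curl`, the profile and `𝔏₂` -/

/-- `curl (c V) = c curl V` at every point, junk values included (`fderiv` of a non-differentiable function is `0` on both sides). [folklore] -/
theorem curl_const_smul_field (c : ℝ) (V : E3 → E3) (x : E3) : curl (fun z => c • V z) x = c • curl V x := by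
  rw [curl_eq_curlCLM, curl_eq_curlCLM, show (fun z => c • V z) = c • V from rfl, fderiv_const_smul_field, Pi.smul_apply, map_smul]

/-- `horizonProfile l (c H) x₀ = c · horizonProfile l H x₀` as functions (everywhere, junk values included). -/
theorem horizonProfile_const_mul (c : ℝ) (l : ℕ) (H : E3 → ℝ) (x₀ : E3) :
    horizonProfile l (fun y => c * H y) x₀ = fun z => c • horizonProfile l H x₀ z := by
  unfold horizonProfile
  have hV : (fun z : E3 => (‖z - x₀‖ ^ ((1 : ℤ) - l) * (c * H (z - x₀))) • (z - x₀))
      = fun z => c • ((‖z - x₀‖ ^ ((1 : ℤ) - l) * H (z - x₀)) • (z - x₀)) := by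
    funext z
    rw [smul_smul]
    congr 1
    ring
  have h1 : curl (fun z : E3 => c • ((‖z - x₀‖ ^ ((1 : ℤ) - l) * H (z - x₀)) • (z - x₀)))
      = fun z => c • curl (fun z : E3 => (‖z - x₀‖ ^ ((1 : ℤ) - l) * H (z - x₀)) • (z - x₀)) z :=
    funext fun z => curl_const_smul_field c _ z
  rw [hV, h1]
  funext z
  exact curl_const_smul_field c _ z

/-- Translation covariance of `curl`: `curl (V(· − a))(x) = (curl V)(x − a)`, junk values included. [folklore] -/
theorem curl_comp_sub (V : E3 → E3) (a x : E3) : curl (fun z => V (z - a)) x = curl V (x - a) := by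
  rw [curl_eq_curlCLM, curl_eq_curlCLM]
  simp only [sub_eq_add_neg]
  rw [fderiv_comp_add_right]

/-- The horizon profile about `x₀` is the profile about `0`, translated. -/
theorem horizonProfile_translate (l : ℕ) (H : E3 → ℝ) (x₀ z : E3) :
    horizonProfile l H x₀ z = horizonProfile l H 0 (z - x₀) := by
  unfold horizonProfile
  simp only [sub_zero]
  have h1 : curl (fun w : E3 => (‖w - x₀‖ ^ ((1 : ℤ) - l) * H (w - x₀)) • (w - x₀))
      = fun w => curl (fun y : E3 => (‖y‖ ^ ((1 : ℤ) - l) * H y) • y) (w - x₀) :=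
    funext fun w => curl_comp_sub (fun y : E3 => (‖y‖ ^ ((1 : ℤ) - l) * H y) • y) x₀ w
  rw [h1, curl_comp_sub]

/-- Translation covariance of `𝔏₂`: `horizonL2 (W(· − x₀)) x₀ x = horizonL2 W 0 (x − x₀)`. -/
theorem horizonL2_translate (W : E3 → E3) (x₀ x : E3) :
    horizonL2 (fun z => W (z - x₀)) x₀ x = horizonL2 W 0 (x - x₀) := by
  have hc : ∀ z : E3, curl (fun z => W (z - x₀)) z = curl W (z - x₀) := fun z => curl_comp_sub W x₀ z
  have k1 : curl (fun z : E3 => cross (cross (W (z - x₀)) (curl W (z - x₀))) (curl W (z - x₀))) x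
      = curl (fun y : E3 => cross (cross (W y) (curl W y)) (curl W y)) (x - x₀) := by
    have h := curl_comp_sub (fun y : E3 => cross (cross (W y) (curl W y)) (curl W y)) x₀ x
    beta_reduce at h
    exact h
  have k2 : ∀ z : E3, curl (fun w : E3 => cross (W (w - x₀)) (curl W (w - x₀))) z
      = curl (fun y : E3 => cross (W y) (curl W y)) (z - x₀) := by
    intro z
    have h := curl_comp_sub (fun y : E3 => cross (W y) (curl W y)) x₀ z
    beta_reduce at h
    exact h
  have k3 : curl (fun z : E3 => cross (W (z - x₀)) (curl (fun y : E3 => cross (W y) (curl W y)) (z - x₀))) x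
      = curl (fun y : E3 => cross (W y) (curl (fun w : E3 => cross (W w) (curl W w)) y)) (x - x₀) := by
    have h := curl_comp_sub (fun y : E3 => cross (W y) (curl (fun w : E3 => cross (W w) (curl W w)) y)) x₀ x
    beta_reduce at h
    exact h
  unfold horizonL2
  simp only [sub_zero, hc, k2]
  rw [k1, k3]

/-! ### The profile about a centre: smoothness off the centre and homogeneity -/

section Profile

variable {l : ℕ} {H : E3 → ℝ}

/-- The horizon profile (centre `0`) is smooth off the origin (`H` smooth, `l`-homogeneous with `l ≥ 1`, harmonic: closed form). -/
theorem contDiffAt_horizonProfile (hl : 1 ≤ l) (hH : ContDiff ℝ (⊤ : ℕ∞) H)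
    (hhom : ∀ (c : ℝ) (y : E3), H (c • y) = c ^ l * H y) (hharm : ∀ y, Laplacian.laplacian H y = 0)
    {z : E3} (hz : z ≠ 0) : ContDiffAt ℝ (⊤ : ℕ∞) (horizonProfile l H 0) z := by
  have hopen : ∀ᶠ w in 𝓝 z, w ≠ (0 : E3) := isOpen_compl_singleton.mem_nhds hz
  have hev : horizonProfile l H 0 =ᶠ[𝓝 z] fun w =>
      (2 * (‖w‖ ^ 2) ^ (((1 : ℝ) - l) / 2)) • gradient H w
        + ((l : ℝ) * (l - 1) * ((‖w‖ ^ 2) ^ (((1 : ℝ) - l) / 2 - 1) * H w)) • w := by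
    filter_upwards [hopen] with w hw using horizonProfile_eq_closedForm hl hH hhom hharm hw
  refine ContDiffAt.congr_of_eventuallyEq ?_ hev
  have hg : ContDiff ℝ (⊤ : ℕ∞) (gradient H) := contDiff_gradient (n := ⊤) hH
  have h1 : ContDiffAt ℝ (⊤ : ℕ∞) (fun w : E3 => (‖w‖ ^ 2) ^ (((1 : ℝ) - l) / 2)) z := contDiffAt_rpow_normSq hz _
  have h2 : ContDiffAt ℝ (⊤ : ℕ∞) (fun w : E3 => (‖w‖ ^ 2) ^ (((1 : ℝ) - l) / 2 - 1)) z := contDiffAt_rpow_normSq hz _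
  exact ((contDiffAt_const.mul h1).smul hg.contDiffAt).add
    ((contDiffAt_const.mul (h2.mul hH.contDiffAt)).smul contDiffAt_id)

/-- The horizon profile about `x₀` is smooth off `x₀`. -/
theorem contDiffOn_horizonProfile_centre (hl : 1 ≤ l) (hH : ContDiff ℝ (⊤ : ℕ∞) H)
    (hhom : ∀ (c : ℝ) (y : E3), H (c • y) = c ^ l * H y) (hharm : ∀ y, Laplacian.laplacian H y = 0) (x₀ : E3) :
    ContDiffOn ℝ (⊤ : ℕ∞) (horizonProfile l H x₀) {x₀}ᶜ := by
  intro z hz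
  have hz' : z - x₀ ≠ 0 := sub_ne_zero.2 hz
  have hfun : horizonProfile l H x₀ = fun w => horizonProfile l H 0 (w - x₀) := funext (horizonProfile_translate l H x₀)
  rw [hfun]
  exact ((contDiffAt_horizonProfile hl hH hhom hharm hz').comp z (contDiffAt_id.sub contDiffAt_const)).contDiffWithinAt

/-- The horizon profile about `x₀` is degree-0 homogeneous about `x₀`. -/
theorem isZeroHomogeneousAbout_horizonProfile_centre (hl : 1 ≤ l) (hH : ContDiff ℝ (⊤ : ℕ∞) H)
    (hhom : ∀ (c : ℝ) (y : E3), H (c • y) = c ^ l * H y) (x₀ : E3) :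
    IsZeroHomogeneousAbout x₀ (horizonProfile l H x₀) := by
  intro c hc y
  rw [horizonProfile_translate, horizonProfile_translate l H x₀ (x₀ + y), add_sub_cancel_left, add_sub_cancel_left]
  have h := isZeroHomogeneousAbout_horizonProfile hl hH hhom c hc y
  rwa [zero_add, zero_add] at h

end Profile

/-! ### Scaling of `det(∇H, ∇‖∇H‖², x)` in `H` and in `x` -/

section Det

variable {l : ℕ} {H : E3 → ℝ}

/-- The gradient of a positively homogeneous function of degree `m ≥ 1` is positively homogeneous of degree `m − 1`. [folklore] -/
theorem gradient_smul_of_posHomogeneous {F : E3 → ℝ} {m : ℕ} (hm : 1 ≤ m) (hFd : ∀ z, DifferentiableAt ℝ F z)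
    (hhom : ∀ c : ℝ, 0 < c → ∀ y : E3, F (c • y) = c ^ m * F y) {c : ℝ} (hc : 0 < c) (y : E3) :
    gradient F (c • y) = c ^ (m - 1) • gradient F y := by
  have hL : HasFDerivAt (fun z : E3 => c • z) (c • ContinuousLinearMap.id ℝ E3) y := (hasFDerivAt_id y).const_smul c
  have h1 : HasFDerivAt (fun z => F (c • z)) ((fderiv ℝ F (c • y)).comp (c • ContinuousLinearMap.id ℝ E3)) y :=
    (hFd (c • y)).hasFDerivAt.comp y hL
  have h2 : HasFDerivAt (fun z => F (c • z)) (c ^ m • fderiv ℝ F y) y := by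
    have : (fun z => F (c • z)) = fun z => c ^ m * F z := funext fun z => hhom c hc z
    rw [this]
    exact (hFd y).hasFDerivAt.const_mul (c ^ m)
  have h3 : (fderiv ℝ F (c • y)).comp (c • ContinuousLinearMap.id ℝ E3) = c ^ m • fderiv ℝ F y := h1.unique h2
  have h4 : c • fderiv ℝ F (c • y) = c • (c ^ (m - 1) • fderiv ℝ F y) := by
    rw [smul_smul, ← pow_succ', Nat.sub_add_cancel hm, ← h3]
    ext v
    simp
  have h5 : fderiv ℝ F (c • y) = c ^ (m - 1) • fderiv ℝ F y := smul_right_injective _ hc.ne' h4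
  apply ext_inner_right ℝ
  intro v
  rw [real_inner_smul_left, Literature.Analysis.FluidPDE.inner_gradient_left,
    Literature.Analysis.FluidPDE.inner_gradient_left, h5]
  simp

/-- `det(∇(cH), ∇‖∇(cH)‖², x) = c³ det(∇H, ∇‖∇H‖², x)`. -/
theorem det_const_mul (hH : ContDiff ℝ (⊤ : ℕ∞) H) (c : ℝ) (x : E3) :
    ⟪gradient (fun y : E3 => c * H y) x,
        cross (gradient (fun w : E3 => ‖gradient (fun y : E3 => c * H y) w‖ ^ 2) x) x⟫
      = c ^ 3 * ⟪gradient H x, cross (gradient (fun w : E3 => ‖gradient H w‖ ^ 2) x) x⟫ := by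
  have hHd : ∀ z, DifferentiableAt ℝ H z := fun z => (hH.differentiable (by simp)).differentiableAt
  have hH2 : ContDiff ℝ 2 H := hH.of_le (by norm_cast)
  have hGd : DifferentiableAt ℝ (fun w : E3 => ‖gradient H w‖ ^ 2) x := (differentiableAt_gradient hH2.contDiffAt).norm_sq ℝ
  have hgc : (fun w : E3 => gradient (fun y : E3 => c * H y) w) = fun w => c • gradient H w :=
    funext fun w => gradient_const_mul' (hHd w) c
  have hGc : (fun w : E3 => ‖gradient (fun y : E3 => c * H y) w‖ ^ 2) = fun w : E3 => c ^ 2 * ‖gradient H w‖ ^ 2 := by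
    funext w
    rw [gradient_const_mul' (hHd w) c, norm_smul, mul_pow, Real.norm_eq_abs, sq_abs]
  rw [hGc, gradient_const_mul' hGd, gradient_const_mul' (hHd x) c, Tao2016.cross_smul_left, real_inner_smul_left,
    real_inner_smul_right]
  ring

/-- `det(∇H, ∇‖∇H‖², ρx) = ρ^{3(l−1)} det(∇H, ∇‖∇H‖², x)` for `ρ > 0` (`H` smooth, `l`-homogeneous, `l ≥ 2`). -/
theorem det_smul (hl : 2 ≤ l) (hH : ContDiff ℝ (⊤ : ℕ∞) H)
    (hhom : ∀ (c : ℝ) (y : E3), H (c • y) = c ^ l * H y) {ρ : ℝ} (hρ : 0 < ρ) (x : E3) :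
    ⟪gradient H (ρ • x), cross (gradient (fun w : E3 => ‖gradient H w‖ ^ 2) (ρ • x)) (ρ • x)⟫
      = ρ ^ (3 * (l - 1)) * ⟪gradient H x, cross (gradient (fun w : E3 => ‖gradient H w‖ ^ 2) x) x⟫ := by
  have hl1 : 1 ≤ l := le_trans (by norm_num) hl
  have hHd : ∀ z, DifferentiableAt ℝ H z := fun z => (hH.differentiable (by simp)).differentiableAt
  have hH2 : ContDiff ℝ 2 H := hH.of_le (by norm_cast)
  have hGd : ∀ z, DifferentiableAt ℝ (fun w : E3 => ‖gradient H w‖ ^ 2) z := fun z =>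
    (differentiableAt_gradient hH2.contDiffAt).norm_sq ℝ
  have hGhom : ∀ c : ℝ, 0 < c → ∀ y : E3, (fun w : E3 => ‖gradient H w‖ ^ 2) (c • y)
      = c ^ (2 * (l - 1)) * (fun w : E3 => ‖gradient H w‖ ^ 2) y := fun c hc y => gradNormSq_smul hl1 hHd hhom hc y
  rw [gradient_smul_of_homogeneous_nat hl1 hHd hhom hρ.ne' x,
    gradient_smul_of_posHomogeneous (m := 2 * (l - 1)) (by omega) hGd hGhom hρ x,
    Tao2016.cross_smul_left, Tao2016.cross_smul_right, real_inner_smul_left, real_inner_smul_right, real_inner_smul_right]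
  have hexp : ρ ^ (l - 1) * (ρ ^ (2 * (l - 1) - 1) * ρ) = ρ ^ (3 * (l - 1)) := by
    rw [← pow_succ, ← pow_add]
    congr 1
    omega
  rw [← hexp]
  ring

/-- `𝔏₂[U_H](ρx) = 0 ↔ 𝔏₂[U_H](x) = 0` for `ρ > 0`, `x ≠ 0`, `l ≥ 2`. -/
theorem horizonL2_horizonProfile_smul_eq_zero_iff (hl : 2 ≤ l) (hH : ContDiff ℝ (⊤ : ℕ∞) H)
    (hhom : ∀ (c : ℝ) (y : E3), H (c • y) = c ^ l * H y) (hharm : ∀ y, Laplacian.laplacian H y = 0)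
    {ρ : ℝ} (hρ : 0 < ρ) {x : E3} (hx : x ≠ 0) :
    horizonL2 (horizonProfile l H 0) 0 (ρ • x) = 0 ↔ horizonL2 (horizonProfile l H 0) 0 x = 0 := by
  have hρx : ρ • x ≠ 0 := smul_ne_zero hρ.ne' hx
  rw [horizonL2_horizonProfile_eq_zero_iff hl hH hhom hharm hρx, horizonL2_horizonProfile_eq_zero_iff hl hH hhom hharm hx,
    det_smul hl hH hhom hρ x, mul_eq_zero]
  have hρk : ρ ^ (3 * (l - 1)) ≠ 0 := pow_ne_zero _ hρ.ne'
  constructor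
  · rintro (h | h)
    · exact absurd h hρk
    · exact h
  · exact fun h => Or.inr h

end Det

/-! ### The rung -/

/-- ★ **`OrderTwoHorizonLaw → BoundedEndpointTailRung`** (the card's «corollary of the lever», by name).  At an interior time of an open
unthreaded window, a slice asymptotic to `c·U_H` (`U_H = horizonProfile l H x₀`, `c ≠ 0`, `l ≥ 2`) with the law's pressure normalisation has
`𝔏₂[U_H] ≡ 0` off `x₀`.  Proof: apply the law to `U = horizonProfile l (cH) x₀ = c·U_H` (smooth off `x₀`, degree-0 homogeneous); the flux
vanishes identically on the open window so `∂ₜ²F(t₀, ·) ≡ 0` and the limit `𝔏₂[U](x₀ + ξ)` is `0` for every unit `ξ`; translate to centre `0`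
and undo `c` and the radius through the closed-form law (`det` is cubic in `H` and homogeneous of degree `3(l−1)` in `x`). -/
theorem boundedEndpointTailRung_of_orderTwoHorizonLaw (hlaw : OrderTwoHorizonLaw) : BoundedEndpointTailRung := by
  intro S u p x₀ t₀ l H P₀ c s₀ δ C hS ht₀ hcl hδ hc hl hH hhom hharm _hnz hP₀ hP₀hom hdecay hpdecay hunthr x hx
  have hl1 : 1 ≤ l := le_trans (by norm_num) hl
  -- the rescaled potential `cH`
  set Hc : E3 → ℝ := fun y => c * H y with hHc
  have hHcC : ContDiff ℝ (⊤ : ℕ∞) Hc := contDiff_const.mul hH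
  have hHchom : ∀ (a : ℝ) (y : E3), Hc (a • y) = a ^ l * Hc y := by
    intro a y
    simp only [hHc, hhom]
    ring
  have hHcharm : ∀ y, Laplacian.laplacian Hc y = 0 := by
    intro y
    have h2 : ContDiffAt ℝ 2 H y := (hH.of_le (by norm_cast)).contDiffAt
    have hfun : Hc = c • H := by funext w; simp [hHc]
    rw [hfun, InnerProductSpace.laplacian_smul c h2, hharm y, smul_zero]
  have hUeq : horizonProfile l Hc x₀ = fun z => c • horizonProfile l H x₀ z := horizonProfile_const_mul c l H x₀
  -- the law applies to `U = horizonProfile l Hc x₀`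
  have hdecay' : ∀ k ≤ 6, ∀ x : E3, 1 ≤ ‖x - x₀‖ →
      ‖iteratedFDeriv ℝ k (fun z => u t₀ z - horizonProfile l Hc x₀ z) x‖ ≤ C * ‖x - x₀‖ ^ (-((k : ℝ) + δ)) := by
    rw [hUeq]
    exact hdecay
  have hlim := hlaw S u p x₀ t₀ (horizonProfile l Hc x₀) P₀ s₀ δ C hS ht₀ hcl hδ
    (contDiffOn_horizonProfile_centre hl1 hHcC hHchom hHcharm x₀)
    (isZeroHomogeneousAbout_horizonProfile_centre hl1 hHcC hHchom x₀) hP₀ hP₀hom hdecay' hpdecay (hunthr t₀ ht₀)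
  -- on the unit sphere about `x₀`, `𝔏₂[U] = 0`
  have hzero : ∀ ξ : E3, ‖ξ‖ = 1 → horizonL2 (horizonProfile l Hc x₀) x₀ (x₀ + ξ) = 0 := by
    intro ξ hξ
    have ht := hlim ξ hξ
    have hF0 : ∀ ρ : ℝ, iteratedDeriv 2 (fun t => threadingFlux u x₀ t (x₀ + ρ • ξ)) t₀ = 0 := by
      intro ρ
      have hev : (fun t => threadingFlux u x₀ t (x₀ + ρ • ξ)) =ᶠ[𝓝 t₀] fun _ => (0 : ℝ) := by
        filter_upwards [hS.mem_nhds ht₀] with t ht using hunthr t ht _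
      rw [hev.iteratedDeriv_eq, iteratedDeriv_const]
      simp
    simp only [hF0, mul_zero] at ht
    exact tendsto_nhds_unique ht tendsto_const_nhds
  -- translate to centre `0`
  have hT : ∀ (K : E3 → ℝ) (z : E3), horizonL2 (horizonProfile l K x₀) x₀ z = horizonL2 (horizonProfile l K 0) 0 (z - x₀) := by
    intro K z
    have hfun : horizonProfile l K x₀ = fun w => horizonProfile l K 0 (w - x₀) := funext (horizonProfile_translate l K x₀)
    rw [hfun, horizonL2_translate]
  rw [hT]
  -- polar decomposition of `x − x₀`
  have hy : x - x₀ ≠ 0 := sub_ne_zero.2 hx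
  set ρ : ℝ := ‖x - x₀‖ with hρ
  have hρ0 : 0 < ρ := norm_pos_iff.2 hy
  set ξ : E3 := ρ⁻¹ • (x - x₀) with hξ
  have hξ1 : ‖ξ‖ = 1 := by
    rw [hξ, norm_smul, Real.norm_of_nonneg (inv_nonneg.2 hρ0.le), hρ, inv_mul_cancel₀ (norm_ne_zero_iff.2 hy)]
  have hξ0 : ξ ≠ 0 := by
    intro h0; rw [h0, norm_zero] at hξ1; exact zero_ne_one hξ1
  have hxdec : x - x₀ = ρ • ξ := by
    rw [hξ, smul_smul, mul_inv_cancel₀ hρ0.ne', one_smul]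
  -- `𝔏₂[U_{cH}](ξ) = 0` about `0`, hence `det_{cH}(ξ) = 0`, hence `det_H(ξ) = 0`, hence `𝔏₂[U_H](x − x₀) = 0`
  have h1 : horizonL2 (horizonProfile l Hc 0) 0 ξ = 0 := by
    have h := hzero ξ hξ1
    rwa [hT, add_sub_cancel_left] at h
  have h2 := (horizonL2_horizonProfile_eq_zero_iff hl hHcC hHchom hHcharm hξ0).1 h1
  rw [hHc, det_const_mul hH c ξ, mul_eq_zero] at h2
  have h3 : ⟪gradient H ξ, cross (gradient (fun w : E3 => ‖gradient H w‖ ^ 2) ξ) ξ⟫ = 0 := by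
    rcases h2 with h | h
    · exact absurd h (pow_ne_zero 3 hc)
    · exact h
  rw [hxdec, horizonL2_horizonProfile_smul_eq_zero_iff hl hH hhom hharm hρ0 hξ0]
  exact (horizonL2_horizonProfile_eq_zero_iff hl hH hhom hharm hξ0).2 h3

end Summit.NavierStokesRegularity.NavierStokesRegularity.Theorems.PoloidalLiouville.HorizonTower

end
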